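import Summits.BirchSwinnertonDyer.BirchSwinnertonDyer.Theorems.ResidualThetaTransportAtTwoResidualSignedLambdaLowerCMAtTwoOfIntDualityData
import Summits.BirchSwinnertonDyer.BirchSwinnertonDyer.Theorems.ResidualThetaTransportAtTwoResidualSignedLambdaLowerCMAtTwoRhoLayerPairingProjection
import Summits.BirchSwinnertonDyer.BirchSwinnertonDyer.Theorems.ResidualThetaTransportAtTwoResidualSignedLambdaLowerCMAtTwoDualGenerator
import Summits.BirchSwinnertonDyer.BirchSwinnertonDyer.Theorems.ResidualThetaTransportAtTwoResidualSignedLambdaLowerCMAtTwoStrictSubmodule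
import Summits.BirchSwinnertonDyer.BirchSwinnertonDyer.Theorems.ResidualThetaTransportAtTwoResidualSignedLambdaLowerCMAtTwoSelmerSubmodules
import Summits.BirchSwinnertonDyer.BirchSwinnertonDyer.Theorems.ResidualThetaTransportAtTwoResidualSignedLambdaLowerCMAtTwoColemanPlusHomTwoCoeff
import Literature.NumberTheory.EllipticCurves.Kato2004.IwasawaCohomologyCoeffNewform
import Literature.NumberTheory.EllipticCurves.BSDConductorProofs
import HarnessLib

/-!
# RSL_g ⟸ (K0a) Kato's datum ∧ (S3) the zeta-element clause ∧ (SUPPLY) the one-pair supply — the composition of skeleton v2a `onepair`, with every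
# pinned object instantiated from landed existence theorems

Route `ResidualThetaTransportAtTwo` (RTT), crux RSL_g `ResidualSignedLambdaLowerCMAtTwo` (stmt-BirchSwinnertonDyer-22608); seat `prover-bsd-wall-rtt-p2` g17
(`--supports`, closes nothing). THEOREMS ONLY. RSL_g is NOT proved here (the three hypotheses are the registered stubs' texts); BSD is not proved by any of this.

`residualSignedLambdaLowerCMAtTwo_of_parts hK0a hS3 hsup : <RSL_g text>` — entry `cmLambdaLower_of_intDualityData` (p679392) with: Kato's datum from
`hK0a = Kato2004.nonempty_iwasawaH1DataCoeff_newform` and its `𝒪`-structure `a ↦ C a`; Frobenius data `t₀` (`ThetaTransport.exists_dualGenerator`, p678260);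
THE `ρ`-coefficient layer Tate pairing family (`ThetaTransport.exists_rhoLayerPairing_pinned_of_crux`, p677952) and its glue `locd₂`
(`ThetaTransport.exists_locd₂_of_layerCores` + `rhoLayerPairingAdic_layerCores`, p679036); the plus Coleman map over `ℤ₂`
(`SignedColemanImage.exists_colemanPlusHom_coeff_two`, p668073); the basis `B` (`exists_addEquiv_padicInt_pi`, p679392); `Sel₀ = StrictAtTwo ⊓ Prim`
(`exists_submodule_strictAtTwo` p671034, `exists_submodule_primitive` p667294); then `hS3` (zeta element `z`, `D`) and `hsup` (the datum).
The skeleton `Cruxes/ResidualSignedLambdaLowerCMAtTwo/Lines/onepair.lean` closes RSL_g BY NAME as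
`residualSignedLambdaLowerCMAtTwo_of_parts stub_katoZetaCMAtTwo.1 stub_katoZetaCMAtTwo.2.2 stub_onePairSupply`.

References: [Kato2004Asterisque] Thm. 12.4–12.5, §13.8; [Kobayashi2003] Thm. 7.3 ((7.21)); [BurungaleTian2026] Thm. 2.6; [PerrinRiou1994Invent] §3.6.1.
-/

set_option autoImplicit false
set_option linter.dupNamespace false
-- the binder blocks of the registered RSL_g signature and of the two stub texts need more than the default budget to elaborate (as in p666435 / p673478)
set_option maxHeartbeats 1600000

noncomputable section

open scoped Classical TensorProduct

namespace Summit.BirchSwinnertonDyer.BirchSwinnertonDyer.Theorems.LambdaLowerBoundO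

open Summit.BirchSwinnertonDyer.BirchSwinnertonDyer.Theorems
open Literature.NumberTheory.EllipticCurves Literature.NumberTheory.EllipticCurves.GreenbergSelmer Literature.NumberTheory.Automorphic
open Literature.NumberTheory.GaloisRepresentations NumberField IsDedekindDomain Field
open Literature.NumberTheory.EllipticCurves GreenbergSelmer GreenbergVatsal2000 Kobayashi2003 ModularForms Rank1Residual Literature.NumberTheory.GaloisRepresentations Literature.NumberTheory.Automorphic IsDedekindDomain NumberField Field Rat.HeightOneSpectrum PowerSeries

/-- **COMPOSITION, abstract in its three inputs** (kernel, no `sorry`): Kato's datum fact (K0a), the zeta-element clause of S3 and the supply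
imply RSL_g BY NAME — entry `LambdaLowerBoundO.cmLambdaLower_of_intDualityData` (p679392) with every pinned object instantiated from landed existence
theorems: Frobenius data `t₀` (`ThetaTransport.exists_dualGenerator`), THE `ρ`-layer Tate pairing family (`ThetaTransport.exists_rhoLayerPairing_pinned_of_crux`),
the glue `locd₂` (`ThetaTransport.exists_locd₂_of_layerCores` + `rhoLayerPairingAdic_layerCores`), the plus Coleman map
(`SignedColemanImage.exists_colemanPlusHom_coeff_two`, `O := ℤ₂`), the basis `B` (`LambdaLowerBoundO.exists_addEquiv_padicInt_pi`),
`Sel₀ = StrictAtTwo ⊓ Prim` (`exists_submodule_strictAtTwo`, `exists_submodule_primitive`). [cite: Kobayashi2003, Thm. 7.3 ((7.21), p. 13)] -/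
theorem residualSignedLambdaLowerCMAtTwo_of_parts
    (hK0a : Literature.NumberTheory.EllipticCurves.Kato2004.nonempty_iwasawaH1DataCoeff_newform)
    (hS3 :
    open Literature.NumberTheory.EllipticCurves GreenbergSelmer GreenbergVatsal2000 Kobayashi2003 ModularForms Rank1Residual Literature.NumberTheory.GaloisRepresentations Literature.NumberTheory.Automorphic IsDedekindDomain NumberField Field Rat.HeightOneSpectrum PowerSeries in ∀ (W : WeierstrassCurve ℚ) [W.IsElliptic] [W.IsGloballyMinimal], ¬ W.HasCM → W.analyticRank = 0 → GoodSS W 2 → W.frobeniusTrace 2 = 0 → W.Δ < 0 → ∀ (M : ℕ) [NeZero M] (g : CuspForm (CongruenceSubgroup.Gamma0 M) 2) (ι : coeffField g →+* PadicAlgCl 2) (Ω : ℂ), Odd M → IsNewform0 g → IsCMForm (liftToGamma1 M 2 g) → cuspCoeff g 2 = 0 → IsCohomologicalPlusPeriod g ι Ω → (∀ ℓ : ℕ, ℓ.Prime → ¬ ℓ ∣ 2 * M * W.conductorNorm ℤ → ‖embCoeff g ι ℓ - (W.frobeniusTrace ℓ : PadicAlgCl 2)‖ < 1) → ∀ (κ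 : ZpExtension ℚ 2) (γ : absoluteGaloisGroup ℚ), κ.IsCyclotomic → κ.IsTopGenerator γ → IsCyclotomicVariable 2 γ → ∀ (S₀ : Finset (HeightOneSpectrum (RingOfIntegers ℚ))), (∀ v ∈ S₀, ((2 : ℕ) : RingOfIntegers ℚ) ∉ v.asIdeal) → (∀ v, ¬ W.HasGoodReductionAt v → v ∈ S₀) → (∀ v, natGenerator v ∣ M → v ∈ S₀) → ∀ (Lp Lm : IwasawaAlgebraO (Set.range ι)) (d : ℕ), IsPollackPairK g ι Ω Lp Lm → (∀ k, ‖coeff k (iwasawaOToPowerSeries (Set.range ι) Lm)‖ ≤ ‖coeff d (iwasawaOToPowerSeries (Set.range ι) Lm)‖) → (∀ k < d, ‖coeff k (iwasawaOToPowerSeries (Set.range ι) Lm)‖ < ‖coeff d (iwasawaOToPowerSeries (Set.range ι) Lm)‖) → ∀ (n : ℕ) (ρ : FramedGaloisRep ℚ ↥(padicCoeffIntegers (Set.range ι)) 2) (Θ : ∀ v : HeightOneSpectrum (RingOfIntegers ℚ), ((2 : ℕ) : RingOfIntegers ℚ) ∈ v.asIdeal → (Cofree ρ ↥(padicCoeffField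 (Set.range ι)) ≃+ (Fin n → ↥(W.geomPrimaryTorsion 2)))), (∀ v, ¬ natGenerator v ∣ 2 * M → ρ.IsUnramifiedAt v ∧ ∃ P : Polynomial ↥(padicCoeffIntegers (Set.range ι)), P.map (padicCoeffIntegers (Set.range ι)).subtype = Polynomial.X ^ 2 - Polynomial.C (embCoeff g ι (natGenerator v)) * Polynomial.X + Polynomial.C ((natGenerator v : ℕ) : PadicAlgCl 2) ∧ ρ.HasFrobCharpolyAt v P) → ∀ (hΘ : ∀ v hv (δ : absoluteGaloisGroup (v.adicCompletion ℚ)) m i, Θ v hv (resGalOfEmb (closureEmb (K := ℚ) (v.adicCompletion ℚ)) δ • m) i = resGalOfEmb (closureEmb (K := ℚ) (v.adicCompletion ℚ)) δ • Θ v hv m i), ∀ (ϖ : ↥(padicCoeffIntegers (Set.range ι))), Irreducible ϖ → ∀ (Sg : AddSubgroup (subgroupH1 κ.kerSubgroup (Cofree ρ ↥(padicCoeffField (Set.range ι))))) [Module ↥(padicCoeffIntegers (Set.range ι)) ↥Sg], (∀ (a : ↥(padicCoeffIntegers (Set.range ι))) (s : ↥Sg), ((a • s : ↥Sg) : subgroupH1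 κ.kerSubgroup (Cofree ρ ↥(padicCoeffField (Set.range ι)))) = scalarH1 κ.kerSubgroup (Cofree ρ ↥(padicCoeffField (Set.range ι))) a s) → (∀ y : subgroupH1 κ.kerSubgroup (Cofree ρ ↥(padicCoeffField (Set.range ι))), y ∈ Sg ↔ y ∈ {y : subgroupH1 κ.kerSubgroup (Cofree ρ ↥(padicCoeffField (Set.range ι))) | y ∈ unramifiedOutside κ.kerSubgroup (Cofree ρ ↥(padicCoeffField (Set.range ι))) 2 ↑S₀ ∧ (∀ w σ, conjH1 κ.kerSubgroup (Cofree ρ ↥(padicCoeffField (Set.range ι))) σ y ∈ infKer κ.kerSubgroup (Cofree ρ ↥(padicCoeffField (Set.range ι))) w) ∧ (∀ v hv σ, ∃ (φ : _) (Q : Fin n → localPoints W (v.adicCompletion ℚ)) (k : ℕ), oneCocycleClass (discreteTopRep ↥κ.kerSubgroup (Cofree ρ ↥(padicCoeffField (Set.range ι)))) φ = conjH1 κ.kerSubgroup (Cofree ρ ↥(padicCoeffField (Set.range ι))) σ y ∧ (∀ i, (2 ^ k) • Q i ∈ ⨆ m : ℕ, signedLocalPoints κ (v.adicCompletion ℚ)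 W 1 m) ∧ ∀ τ i, pointsMapOfEmb W (closureEmb (K := ℚ) (v.adicCompletion ℚ)) (((Θ v hv (φ.1 (resGalSubgroupOfEmb κ.kerSubgroup (closureEmb (K := ℚ) (v.adicCompletion ℚ)) τ))) i : ↥(W.geomPrimaryTorsion 2)) : W.geomPoints) = (τ : absoluteGaloisGroup (v.adicCompletion ℚ)) • Q i - Q i)}) → (∀ (τ : absoluteGaloisGroup ℚ) (y : subgroupH1 κ.kerSubgroup (Cofree ρ ↥(padicCoeffField (Set.range ι)))), y ∈ Sg → conjH1 κ.kerSubgroup (Cofree ρ ↥(padicCoeffField (Set.range ι))) τ y ∈ Sg) → ({y : subgroupH1 κ.kerSubgroup (Cofree ρ ↥(padicCoeffField (Set.range ι))) | y ∈ unramifiedOutside κ.kerSubgroup (Cofree ρ ↥(padicCoeffField (Set.range ι))) 2 ↑S₀ ∧ (∀ w σ, conjH1 κ.kerSubgroup (Cofree ρ ↥(padicCoeffField (Set.range ι))) σ y ∈ infKer κ.kerSubgroup (Cofree ρ ↥(padicCoeffField (Set.range ι))) w) ∧ (∀ v hv σ, ∃ (φ : _) (Q : Fin n → localPoints W (v.adicCompletion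 ℚ)) (k : ℕ), oneCocycleClass (discreteTopRep ↥κ.kerSubgroup (Cofree ρ ↥(padicCoeffField (Set.range ι)))) φ = conjH1 κ.kerSubgroup (Cofree ρ ↥(padicCoeffField (Set.range ι))) σ y ∧ (∀ i, (2 ^ k) • Q i ∈ ⨆ m : ℕ, signedLocalPoints κ (v.adicCompletion ℚ) W 1 m) ∧ ∀ τ i, pointsMapOfEmb W (closureEmb (K := ℚ) (v.adicCompletion ℚ)) (((Θ v hv (φ.1 (resGalSubgroupOfEmb κ.kerSubgroup (closureEmb (K := ℚ) (v.adicCompletion ℚ)) τ))) i : ↥(W.geomPrimaryTorsion 2)) : W.geomPoints) = (τ : absoluteGaloisGroup (v.adicCompletion ℚ)) • Q i - Q i) ∧ scalarH1 κ.kerSubgroup (Cofree ρ ↥(padicCoeffField (Set.range ι))) ϖ y = 0} : Set _).Finite → ∀ (v : HeightOneSpectrum (RingOfIntegers ℚ)) (hv : ((2 : ℕ) : RingOfIntegers ℚ) ∈ v.asIdeal) (I : Kato2004.IwasawaH1DataCoeff (FramedGaloisRep.toGaloisRep ρ) 2 κ γ) [Module ↥(padicCoeffIntegers (Set.range ι))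 I.H] [IsScalarTower ↥(padicCoeffIntegers (Set.range ι)) (IwasawaAlgebraO (Set.range ι)) I.H], (∀ (a : ↥(padicCoeffIntegers (Set.range ι))) (x : I.H), a • x = (PowerSeries.C a : IwasawaAlgebraO (Set.range ι)) • x) → ∀ (t₀ : ↥(padicCoeffIntegers (Set.range ι)) →+ ℤ_[2]), (∀ (c : ℤ_[2]) (a : ↥(padicCoeffIntegers (Set.range ι))), t₀ (padicIntToCoeffIntegers (Set.range ι) c * a) = c * t₀ a) → ∀ (nb : ℕ) (bO bO' : Fin nb → ↥(padicCoeffIntegers (Set.range ι))), (∀ a : ↥(padicCoeffIntegers (Set.range ι)), a = ∑ i, padicIntToCoeffIntegers (Set.range ι) (t₀ (a * bO' i)) * bO i) → ∀ (ζ : ℕ → AlgebraicClosure ℚ), (∀ k, IsPrimitiveRoot (ζ k) (2 ^ k)) → ∀ (ePk : ∀ k : ℕ, ↥(AddSubgroup.torsionBy (Cofree ρ ↥(padicCoeffField (Set.range ι))) ((2 ^ k : ℕ) : ℤ)) → ↥(AddSubgroup.torsionBy (Cofree ρ ↥(padicCoeffField (Set.range ι))) ((2 ^ k : ℕ) : ℤ))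 → AlgebraicClosure ℚ) (hμPk : ∀ k a b, ePk k a b ^ (2 ^ k) = 1) (hadd₁Pk : ∀ k a₁ a₂ b, ePk k (a₁ + a₂) b = ePk k a₁ b * ePk k a₂ b) (hadd₂Pk : ∀ k a b₁ b₂, ePk k a (b₁ + b₂) = ePk k a b₁ * ePk k a b₂) (hgalPk : ∀ k (σ : absoluteGaloisGroup ℚ) (a b : ↥(AddSubgroup.torsionBy (Cofree ρ ↥(padicCoeffField (Set.range ι))) ((2 ^ k : ℕ) : ℤ))), σ • ePk k a b = ePk k (cofreeTorsionGaloisModule (Set.range ι) ρ _ σ a) (cofreeTorsionGaloisModule (Set.range ι) ρ _ σ b)), (∀ k (s t : Fin 2 → ↥(padicCoeffIntegers (Set.range ι))), ePk k (divPowCofreeMkTorsion (Set.range ι) ρ k s) (divPowCofreeMkTorsion (Set.range ι) ρ k t) = ζ k ^ (PadicInt.toZModPow k (t₀ (s 0 * t 1 - s 1 * t 0))).val) → ∀ (pair : ∀ m : ℕ, H1 (FramedGaloisRep.toGaloisRep ρ) (κ.layerSubgroup m) →+ ((Fin n → ↥(localLayerPointsOfEmb κ (closureEmb (K := ℚ)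 (v.adicCompletion ℚ)) W m)) →+ ℤ_[2])), (∀ (m k : ℕ) (x : H1 (FramedGaloisRep.toGaloisRep ρ) (κ.layerSubgroup m)) (Q : Fin n → ↥(localLayerPointsOfEmb κ (closureEmb (K := ℚ) (v.adicCompletion ℚ)) W m)), PadicInt.toZModPow k (pair m x Q) = CyclotomicLayer.rhoLayerPairingPk (Set.range ι) ρ W ePk hμPk hadd₁Pk hadd₂Pk hgalPk (Θ v hv) κ v (hΘ v hv) m k x Q) → ∀ (locd₂ : I.H →+ ((Fin n → ↥(Sprung2012.localTowerPointsOfEmb κ (closureEmb (K := ℚ) (v.adicCompletion ℚ)) W)) →+ ℤ_[2])), (∀ (m : ℕ) (x : I.H) (Q : Fin n → localPoints W (v.adicCompletion ℚ)) (hQ : ∀ i, Q i ∈ localLayerPointsOfEmb κ (closureEmb (K := ℚ) (v.adicCompletion ℚ)) W m), locd₂ x (fun i => ⟨Q i, Sprung2012.localLayerPointsOfEmb_le_localTowerPointsOfEmb κ (closureEmb (K := ℚ) (v.adicCompletion ℚ)) W m (hQ i)⟩) = pair m (I.proj m x) (fun i => ⟨Q i, hQ i⟩)) → ∀ (col : (↥(Sprung2012.localTowerPointsOfEmb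 κ (closureEmb (K := ℚ) (v.adicCompletion ℚ)) W) →+ ℤ_[2]) →ₗ[ℤ_[2]] PowerSeries ℤ_[2]), (∃ (gH : absoluteGaloisGroup (v.adicCompletion ℚ)) (dH : ℕ → localPoints W (v.adicCompletion ℚ)) (hdA : ∀ m j, gH ^ j • dH m ∈ Sprung2012.localTowerPointsOfEmb κ (closureEmb (K := ℚ) (v.adicCompletion ℚ)) W), κ.IsTopGenerator (resGalOfEmb (closureEmb (K := ℚ) (v.adicCompletion ℚ)) gH) ∧ (∀ m, dH m ∈ localLayerPointsOfEmb κ (closureEmb (K := ℚ) (v.adicCompletion ℚ)) W m) ∧ (∀ m, localTraceOfEmb κ (closureEmb (K := ℚ) (v.adicCompletion ℚ)) W (m + 1) (m + 2) (dH (m + 2)) = -dH m) ∧ (∀ b ∈ localLayerPointsOfEmb κ (closureEmb (K := ℚ) (v.adicCompletion ℚ)) W 0, dH 0 ≠ 2 • b) ∧ (∀ (z : ↥(Sprung2012.localTowerPointsOfEmb κ (closureEmb (K := ℚ) (v.adicCompletion ℚ)) W) →+ ℤ_[2]) (m : ℕ), (((cyclotomicOmega 2 (2 * m)).map (Int.castRingHom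 ℤ_[2]) : Polynomial ℤ_[2]) : PowerSeries ℤ_[2]) ∣ ((∑ j ∈ Finset.range (2 ^ (2 * m)), Polynomial.C (z ⟨gH ^ j • dH (2 * m), hdA (2 * m) j⟩) * (Polynomial.X + 1) ^ j : Polynomial ℤ_[2]) : PowerSeries ℤ_[2]) + (-1 : PowerSeries ℤ_[2]) ^ m * (((cyclotomicOmegaMinus 2 (2 * m)).map (Int.castRingHom ℤ_[2]) : Polynomial ℤ_[2]) : PowerSeries ℤ_[2]) * col z) ∧ (∀ (z : ↥(Sprung2012.localTowerPointsOfEmb κ (closureEmb (K := ℚ) (v.adicCompletion ℚ)) W) →+ ℤ_[2]) (Lz : PowerSeries ℤ_[2]), (∀ m : ℕ, (((cyclotomicOmega 2 (2 * m)).map (Int.castRingHom ℤ_[2]) : Polynomial ℤ_[2]) : PowerSeries ℤ_[2]) ∣ ((∑ j ∈ Finset.range (2 ^ (2 * m)), Polynomial.C (z ⟨gH ^ j • dH (2 * m), hdA (2 * m) j⟩) * (Polynomial.X + 1) ^ j : Polynomial ℤ_[2]) : PowerSeries ℤ_[2]) + (-1 : PowerSeries ℤ_[2]) ^ m * (((cyclotomicOmegaMinus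 2 (2 * m)).map (Int.castRingHom ℤ_[2]) : Polynomial ℤ_[2]) : PowerSeries ℤ_[2]) * Lz) → Lz = col z)) → Function.Surjective col → (∀ z : ↥(Sprung2012.localTowerPointsOfEmb κ (closureEmb (K := ℚ) (v.adicCompletion ℚ)) W) →+ ℤ_[2], col z = 0 ↔ ∀ (m : ℕ) (x : localPoints W (v.adicCompletion ℚ)) (hx : x ∈ signedLocalPoints κ (v.adicCompletion ℚ) W 1 m), z ⟨x, Sprung2012.localLayerPointsOfEmb_le_localTowerPointsOfEmb κ (closureEmb (K := ℚ) (v.adicCompletion ℚ)) W m (signedLocalPointsOfEmb_le κ (closureEmb (K := ℚ) (v.adicCompletion ℚ)) W 1 m hx)⟩ = 0) → ∀ (f : ℕ) (B : (Fin f → ℤ_[2]) ≃+ ↥(padicCoeffIntegers (Set.range ι))), (∀ (c : ℤ_[2]) (y : Fin f → ℤ_[2]), B (c • y) = padicIntToCoeffIntegers (Set.range ι) c * B y) → ∀ (Sel₀ : Submodule ↥(padicCoeffIntegers (Set.range ι)) ↥Sg), (∀ s : ↥Sg, s ∈ Sel₀ ↔ (∀ (v' : HeightOneSpectrum (RingOfIntegers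 ℚ)) (hv' : ((2 : ℕ) : RingOfIntegers ℚ) ∈ v'.asIdeal) (σ : absoluteGaloisGroup ℚ), ∃ (φ : contOneCocycles (discreteTopRep ↥κ.kerSubgroup (Cofree ρ ↥(padicCoeffField (Set.range ι))))) (Q : Fin n → localPoints W (v'.adicCompletion ℚ)) (k : ℕ), oneCocycleClass (discreteTopRep ↥κ.kerSubgroup (Cofree ρ ↥(padicCoeffField (Set.range ι)))) φ = conjH1 κ.kerSubgroup (Cofree ρ ↥(padicCoeffField (Set.range ι))) σ (s : subgroupH1 κ.kerSubgroup (Cofree ρ ↥(padicCoeffField (Set.range ι)))) ∧ (∀ i, (2 ^ k) • Q i ∈ (⊥ : AddSubgroup (localPoints W (v'.adicCompletion ℚ)))) ∧ ∀ (τ : ↥(localSubgroupOfEmb κ.kerSubgroup (closureEmb (K := ℚ) (v'.adicCompletion ℚ)))) (i : Fin n), pointsMapOfEmb W (closureEmb (K := ℚ) (v'.adicCompletion ℚ)) ((Θ v' hv' (φ.1 (resGalSubgroupOfEmb κ.kerSubgroup (closureEmb (K := ℚ) (v'.adicCompletion ℚ)) τ)) i : ↥(W.geomPrimaryTorsion 2))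 : W.geomPoints) = (τ : absoluteGaloisGroup (v'.adicCompletion ℚ)) • Q i - Q i) ∧ (∀ w ∈ S₀, ∀ σ : absoluteGaloisGroup ℚ, conjH1 κ.kerSubgroup (Cofree ρ ↥(padicCoeffField (Set.range ι))) σ (s : subgroupH1 κ.kerSubgroup (Cofree ρ ↥(padicCoeffField (Set.range ι)))) ∈ unramifiedKer κ.kerSubgroup (Cofree ρ ↥(padicCoeffField (Set.range ι))) w)) → ∃ (z : I.H) (D : IwasawaAlgebraO (Set.range ι)), D ≠ 0 ∧ Module.Finite ℚ_[2] (TensorProduct ℤ_[2] ℚ_[2] ((Fin n → PowerSeries ℤ_[2]) ⧸ Submodule.span (PowerSeries ℤ_[2]) ((fun x : I.H => fun i : Fin n => col ((locd₂ x).comp (AddMonoidHom.single (fun _ : Fin n => ↥(Sprung2012.localTowerPointsOfEmb κ (closureEmb (K := ℚ) (v.adicCompletion ℚ)) W)) i))) '' (↑(Submodule.span (IwasawaAlgebraO (Set.range ι)) ({z} : Set I.H)) : Set I.H)))) ∧ f * (d + Module.finrank (FractionRing ↥(padicCoeffIntegers (Set.range ι))) (TensorProduct ↥(padicCoeffIntegers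 (Set.range ι)) (FractionRing ↥(padicCoeffIntegers (Set.range ι))) (IwasawaAlgebraO (Set.range ι) ⧸ Ideal.span {D}))) ≤ Module.finrank ℚ_[2] (TensorProduct ℤ_[2] ℚ_[2] ((Fin n → PowerSeries ℤ_[2]) ⧸ Submodule.span (PowerSeries ℤ_[2]) ((fun x : I.H => fun i : Fin n => col ((locd₂ x).comp (AddMonoidHom.single (fun _ : Fin n => ↥(Sprung2012.localTowerPointsOfEmb κ (closureEmb (K := ℚ) (v.adicCompletion ℚ)) W)) i))) '' (↑(Submodule.span (IwasawaAlgebraO (Set.range ι)) ({z} : Set I.H)) : Set I.H)))) ∧ Module.Finite (FractionRing ↥(padicCoeffIntegers (Set.range ι))) (TensorProduct ↥(padicCoeffIntegers (Set.range ι)) (FractionRing ↥(padicCoeffIntegers (Set.range ι))) (I.H ⧸ Submodule.span (IwasawaAlgebraO (Set.range ι)) ({z} : Set I.H))) ∧ Module.finrank (FractionRing ↥(padicCoeffIntegers (Set.range ι))) (TensorProduct ↥(padicCoeffIntegers (Set.range ι)) (FractionRing ↥(padicCoeffIntegers (Set.range ι))) (I.H ⧸ Submodule.span (IwasawaAlgebraO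 (Set.range ι)) ({z} : Set I.H))) ≤ Module.finrank (FractionRing ↥(padicCoeffIntegers (Set.range ι))) (TensorProduct ↥(padicCoeffIntegers (Set.range ι)) (FractionRing ↥(padicCoeffIntegers (Set.range ι))) (CharacterModule ↥Sel₀)) + Module.finrank (FractionRing ↥(padicCoeffIntegers (Set.range ι))) (TensorProduct ↥(padicCoeffIntegers (Set.range ι)) (FractionRing ↥(padicCoeffIntegers (Set.range ι))) (IwasawaAlgebraO (Set.range ι) ⧸ Ideal.span {D})))
    (hsup :
    open Literature.NumberTheory.EllipticCurves GreenbergSelmer GreenbergVatsal2000 Kobayashi2003 ModularForms Rank1Residual Literature.NumberTheory.GaloisRepresentations Literature.NumberTheory.Automorphic IsDedekindDomain NumberField Field Rat.HeightOneSpectrum PowerSeries in ∀ (W : WeierstrassCurve ℚ) [W.IsElliptic] [W.IsGloballyMinimal], ¬ W.HasCM → W.analyticRank = 0 → GoodSS W 2 → W.frobeniusTrace 2 = 0 → W.Δ < 0 → ∀ (M : ℕ) [NeZero M] (g : CuspForm (CongruenceSubgroup.Gamma0 M) 2) (ι : coeffField g →+* PadicAlgCl 2) (Ω : ℂ), Odd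 M → IsNewform0 g → IsCMForm (liftToGamma1 M 2 g) → cuspCoeff g 2 = 0 → IsCohomologicalPlusPeriod g ι Ω → (∀ ℓ : ℕ, ℓ.Prime → ¬ ℓ ∣ 2 * M * W.conductorNorm ℤ → ‖embCoeff g ι ℓ - (W.frobeniusTrace ℓ : PadicAlgCl 2)‖ < 1) → ∀ (κ : ZpExtension ℚ 2) (γ : absoluteGaloisGroup ℚ), κ.IsCyclotomic → κ.IsTopGenerator γ → IsCyclotomicVariable 2 γ → ∀ (S₀ : Finset (HeightOneSpectrum (RingOfIntegers ℚ))), (∀ v ∈ S₀, ((2 : ℕ) : RingOfIntegers ℚ) ∉ v.asIdeal) → (∀ v, ¬ W.HasGoodReductionAt v → v ∈ S₀) → (∀ v, natGenerator v ∣ M → v ∈ S₀) → ∀ (Lp Lm : IwasawaAlgebraO (Set.range ι)) (d : ℕ), IsPollackPairK g ι Ω Lp Lm → (∀ k, ‖coeff k (iwasawaOToPowerSeries (Set.range ι) Lm)‖ ≤ ‖coeff d (iwasawaOToPowerSeries (Set.range ι) Lm)‖) → (∀ k < d, ‖coeff k (iwasawaOToPowerSeries (Set.range ι) Lm)‖ <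 ‖coeff d (iwasawaOToPowerSeries (Set.range ι) Lm)‖) → ∀ (n : ℕ) (ρ : FramedGaloisRep ℚ ↥(padicCoeffIntegers (Set.range ι)) 2) (Θ : ∀ v : HeightOneSpectrum (RingOfIntegers ℚ), ((2 : ℕ) : RingOfIntegers ℚ) ∈ v.asIdeal → (Cofree ρ ↥(padicCoeffField (Set.range ι)) ≃+ (Fin n → ↥(W.geomPrimaryTorsion 2)))), (∀ v, ¬ natGenerator v ∣ 2 * M → ρ.IsUnramifiedAt v ∧ ∃ P : Polynomial ↥(padicCoeffIntegers (Set.range ι)), P.map (padicCoeffIntegers (Set.range ι)).subtype = Polynomial.X ^ 2 - Polynomial.C (embCoeff g ι (natGenerator v)) * Polynomial.X + Polynomial.C ((natGenerator v : ℕ) : PadicAlgCl 2) ∧ ρ.HasFrobCharpolyAt v P) → ∀ (hΘ : ∀ v hv (δ : absoluteGaloisGroup (v.adicCompletion ℚ)) m i, Θ v hv (resGalOfEmb (closureEmb (K := ℚ) (v.adicCompletion ℚ)) δ • m) i = resGalOfEmb (closureEmb (K := ℚ) (v.adicCompletion ℚ)) δ • Θ v hv m i), ∀ (ϖ : ↥(padicCoeffIntegers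 (Set.range ι))), Irreducible ϖ → ∀ (Sg : AddSubgroup (subgroupH1 κ.kerSubgroup (Cofree ρ ↥(padicCoeffField (Set.range ι))))) [Module ↥(padicCoeffIntegers (Set.range ι)) ↥Sg], (∀ (a : ↥(padicCoeffIntegers (Set.range ι))) (s : ↥Sg), ((a • s : ↥Sg) : subgroupH1 κ.kerSubgroup (Cofree ρ ↥(padicCoeffField (Set.range ι)))) = scalarH1 κ.kerSubgroup (Cofree ρ ↥(padicCoeffField (Set.range ι))) a s) → (∀ y : subgroupH1 κ.kerSubgroup (Cofree ρ ↥(padicCoeffField (Set.range ι))), y ∈ Sg ↔ y ∈ {y : subgroupH1 κ.kerSubgroup (Cofree ρ ↥(padicCoeffField (Set.range ι))) | y ∈ unramifiedOutside κ.kerSubgroup (Cofree ρ ↥(padicCoeffField (Set.range ι))) 2 ↑S₀ ∧ (∀ w σ, conjH1 κ.kerSubgroup (Cofree ρ ↥(padicCoeffField (Set.range ι))) σ y ∈ infKer κ.kerSubgroup (Cofree ρ ↥(padicCoeffField (Set.range ι))) w) ∧ (∀ v hv σ, ∃ (φ : _) (Q : Fin n → localPoints W (v.adicCompletion ℚ))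 (k : ℕ), oneCocycleClass (discreteTopRep ↥κ.kerSubgroup (Cofree ρ ↥(padicCoeffField (Set.range ι)))) φ = conjH1 κ.kerSubgroup (Cofree ρ ↥(padicCoeffField (Set.range ι))) σ y ∧ (∀ i, (2 ^ k) • Q i ∈ ⨆ m : ℕ, signedLocalPoints κ (v.adicCompletion ℚ) W 1 m) ∧ ∀ τ i, pointsMapOfEmb W (closureEmb (K := ℚ) (v.adicCompletion ℚ)) (((Θ v hv (φ.1 (resGalSubgroupOfEmb κ.kerSubgroup (closureEmb (K := ℚ) (v.adicCompletion ℚ)) τ))) i : ↥(W.geomPrimaryTorsion 2)) : W.geomPoints) = (τ : absoluteGaloisGroup (v.adicCompletion ℚ)) • Q i - Q i)}) → (∀ (τ : absoluteGaloisGroup ℚ) (y : subgroupH1 κ.kerSubgroup (Cofree ρ ↥(padicCoeffField (Set.range ι)))), y ∈ Sg → conjH1 κ.kerSubgroup (Cofree ρ ↥(padicCoeffField (Set.range ι))) τ y ∈ Sg) → ({y : subgroupH1 κ.kerSubgroup (Cofree ρ ↥(padicCoeffField (Set.range ι))) | y ∈ unramifiedOutside κ.kerSubgroup (Cofree ρ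 ↥(padicCoeffField (Set.range ι))) 2 ↑S₀ ∧ (∀ w σ, conjH1 κ.kerSubgroup (Cofree ρ ↥(padicCoeffField (Set.range ι))) σ y ∈ infKer κ.kerSubgroup (Cofree ρ ↥(padicCoeffField (Set.range ι))) w) ∧ (∀ v hv σ, ∃ (φ : _) (Q : Fin n → localPoints W (v.adicCompletion ℚ)) (k : ℕ), oneCocycleClass (discreteTopRep ↥κ.kerSubgroup (Cofree ρ ↥(padicCoeffField (Set.range ι)))) φ = conjH1 κ.kerSubgroup (Cofree ρ ↥(padicCoeffField (Set.range ι))) σ y ∧ (∀ i, (2 ^ k) • Q i ∈ ⨆ m : ℕ, signedLocalPoints κ (v.adicCompletion ℚ) W 1 m) ∧ ∀ τ i, pointsMapOfEmb W (closureEmb (K := ℚ) (v.adicCompletion ℚ)) (((Θ v hv (φ.1 (resGalSubgroupOfEmb κ.kerSubgroup (closureEmb (K := ℚ) (v.adicCompletion ℚ)) τ))) i : ↥(W.geomPrimaryTorsion 2)) : W.geomPoints) = (τ : absoluteGaloisGroup (v.adicCompletion ℚ)) • Q i - Q i) ∧ scalarH1 κ.kerSubgroup (Cofree ρ ↥(padicCoeffField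 (Set.range ι))) ϖ y = 0} : Set _).Finite → ∀ (v : HeightOneSpectrum (RingOfIntegers ℚ)) (hv : ((2 : ℕ) : RingOfIntegers ℚ) ∈ v.asIdeal) (I : Kato2004.IwasawaH1DataCoeff (FramedGaloisRep.toGaloisRep ρ) 2 κ γ) [Module ↥(padicCoeffIntegers (Set.range ι)) I.H] [IsScalarTower ↥(padicCoeffIntegers (Set.range ι)) (IwasawaAlgebraO (Set.range ι)) I.H], (∀ (a : ↥(padicCoeffIntegers (Set.range ι))) (x : I.H), a • x = (PowerSeries.C a : IwasawaAlgebraO (Set.range ι)) • x) → ∀ (t₀ : ↥(padicCoeffIntegers (Set.range ι)) →+ ℤ_[2]), (∀ (c : ℤ_[2]) (a : ↥(padicCoeffIntegers (Set.range ι))), t₀ (padicIntToCoeffIntegers (Set.range ι) c * a) = c * t₀ a) → ∀ (nb : ℕ) (bO bO' : Fin nb → ↥(padicCoeffIntegers (Set.range ι))), (∀ a : ↥(padicCoeffIntegers (Set.range ι)), a = ∑ i, padicIntToCoeffIntegers (Set.range ι) (t₀ (a * bO' i)) * bO i) → ∀ (ζ : ℕ → AlgebraicClosure ℚ), (∀ k,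 IsPrimitiveRoot (ζ k) (2 ^ k)) → ∀ (ePk : ∀ k : ℕ, ↥(AddSubgroup.torsionBy (Cofree ρ ↥(padicCoeffField (Set.range ι))) ((2 ^ k : ℕ) : ℤ)) → ↥(AddSubgroup.torsionBy (Cofree ρ ↥(padicCoeffField (Set.range ι))) ((2 ^ k : ℕ) : ℤ)) → AlgebraicClosure ℚ) (hμPk : ∀ k a b, ePk k a b ^ (2 ^ k) = 1) (hadd₁Pk : ∀ k a₁ a₂ b, ePk k (a₁ + a₂) b = ePk k a₁ b * ePk k a₂ b) (hadd₂Pk : ∀ k a b₁ b₂, ePk k a (b₁ + b₂) = ePk k a b₁ * ePk k a b₂) (hgalPk : ∀ k (σ : absoluteGaloisGroup ℚ) (a b : ↥(AddSubgroup.torsionBy (Cofree ρ ↥(padicCoeffField (Set.range ι))) ((2 ^ k : ℕ) : ℤ))), σ • ePk k a b = ePk k (cofreeTorsionGaloisModule (Set.range ι) ρ _ σ a) (cofreeTorsionGaloisModule (Set.range ι) ρ _ σ b)), (∀ k (s t : Fin 2 → ↥(padicCoeffIntegers (Set.range ι))), ePk k (divPowCofreeMkTorsion (Set.range ι) ρ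 k s) (divPowCofreeMkTorsion (Set.range ι) ρ k t) = ζ k ^ (PadicInt.toZModPow k (t₀ (s 0 * t 1 - s 1 * t 0))).val) → ∀ (pair : ∀ m : ℕ, H1 (FramedGaloisRep.toGaloisRep ρ) (κ.layerSubgroup m) →+ ((Fin n → ↥(localLayerPointsOfEmb κ (closureEmb (K := ℚ) (v.adicCompletion ℚ)) W m)) →+ ℤ_[2])), (∀ (m k : ℕ) (x : H1 (FramedGaloisRep.toGaloisRep ρ) (κ.layerSubgroup m)) (Q : Fin n → ↥(localLayerPointsOfEmb κ (closureEmb (K := ℚ) (v.adicCompletion ℚ)) W m)), PadicInt.toZModPow k (pair m x Q) = CyclotomicLayer.rhoLayerPairingPk (Set.range ι) ρ W ePk hμPk hadd₁Pk hadd₂Pk hgalPk (Θ v hv) κ v (hΘ v hv) m k x Q) → ∀ (locd₂ : I.H →+ ((Fin n → ↥(Sprung2012.localTowerPointsOfEmb κ (closureEmb (K := ℚ) (v.adicCompletion ℚ)) W)) →+ ℤ_[2])), (∀ (m : ℕ) (x : I.H) (Q : Fin n → localPoints W (v.adicCompletion ℚ)) (hQ : ∀ i, Q i ∈ localLayerPointsOfEmb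 κ (closureEmb (K := ℚ) (v.adicCompletion ℚ)) W m), locd₂ x (fun i => ⟨Q i, Sprung2012.localLayerPointsOfEmb_le_localTowerPointsOfEmb κ (closureEmb (K := ℚ) (v.adicCompletion ℚ)) W m (hQ i)⟩) = pair m (I.proj m x) (fun i => ⟨Q i, hQ i⟩)) → ∀ (col : (↥(Sprung2012.localTowerPointsOfEmb κ (closureEmb (K := ℚ) (v.adicCompletion ℚ)) W) →+ ℤ_[2]) →ₗ[ℤ_[2]] PowerSeries ℤ_[2]), (∃ (gH : absoluteGaloisGroup (v.adicCompletion ℚ)) (dH : ℕ → localPoints W (v.adicCompletion ℚ)) (hdA : ∀ m j, gH ^ j • dH m ∈ Sprung2012.localTowerPointsOfEmb κ (closureEmb (K := ℚ) (v.adicCompletion ℚ)) W), κ.IsTopGenerator (resGalOfEmb (closureEmb (K := ℚ) (v.adicCompletion ℚ)) gH) ∧ (∀ m, dH m ∈ localLayerPointsOfEmb κ (closureEmb (K := ℚ) (v.adicCompletion ℚ)) W m) ∧ (∀ m, localTraceOfEmb κ (closureEmb (K := ℚ) (v.adicCompletion ℚ)) W (m + 1) (m + 2) (dH (m + 2)) =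 -dH m) ∧ (∀ b ∈ localLayerPointsOfEmb κ (closureEmb (K := ℚ) (v.adicCompletion ℚ)) W 0, dH 0 ≠ 2 • b) ∧ (∀ (z : ↥(Sprung2012.localTowerPointsOfEmb κ (closureEmb (K := ℚ) (v.adicCompletion ℚ)) W) →+ ℤ_[2]) (m : ℕ), (((cyclotomicOmega 2 (2 * m)).map (Int.castRingHom ℤ_[2]) : Polynomial ℤ_[2]) : PowerSeries ℤ_[2]) ∣ ((∑ j ∈ Finset.range (2 ^ (2 * m)), Polynomial.C (z ⟨gH ^ j • dH (2 * m), hdA (2 * m) j⟩) * (Polynomial.X + 1) ^ j : Polynomial ℤ_[2]) : PowerSeries ℤ_[2]) + (-1 : PowerSeries ℤ_[2]) ^ m * (((cyclotomicOmegaMinus 2 (2 * m)).map (Int.castRingHom ℤ_[2]) : Polynomial ℤ_[2]) : PowerSeries ℤ_[2]) * col z) ∧ (∀ (z : ↥(Sprung2012.localTowerPointsOfEmb κ (closureEmb (K := ℚ) (v.adicCompletion ℚ)) W) →+ ℤ_[2]) (Lz : PowerSeries ℤ_[2]), (∀ m : ℕ, (((cyclotomicOmega 2 (2 * m)).map (Int.castRingHom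 ℤ_[2]) : Polynomial ℤ_[2]) : PowerSeries ℤ_[2]) ∣ ((∑ j ∈ Finset.range (2 ^ (2 * m)), Polynomial.C (z ⟨gH ^ j • dH (2 * m), hdA (2 * m) j⟩) * (Polynomial.X + 1) ^ j : Polynomial ℤ_[2]) : PowerSeries ℤ_[2]) + (-1 : PowerSeries ℤ_[2]) ^ m * (((cyclotomicOmegaMinus 2 (2 * m)).map (Int.castRingHom ℤ_[2]) : Polynomial ℤ_[2]) : PowerSeries ℤ_[2]) * Lz) → Lz = col z)) → Function.Surjective col → (∀ z : ↥(Sprung2012.localTowerPointsOfEmb κ (closureEmb (K := ℚ) (v.adicCompletion ℚ)) W) →+ ℤ_[2], col z = 0 ↔ ∀ (m : ℕ) (x : localPoints W (v.adicCompletion ℚ)) (hx : x ∈ signedLocalPoints κ (v.adicCompletion ℚ) W 1 m), z ⟨x, Sprung2012.localLayerPointsOfEmb_le_localTowerPointsOfEmb κ (closureEmb (K := ℚ) (v.adicCompletion ℚ)) W m (signedLocalPointsOfEmb_le κ (closureEmb (K := ℚ) (v.adicCompletion ℚ)) W 1 m hx)⟩ = 0) → ∀ (f : ℕ) (B : (Fin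 f → ℤ_[2]) ≃+ ↥(padicCoeffIntegers (Set.range ι))), (∀ (c : ℤ_[2]) (y : Fin f → ℤ_[2]), B (c • y) = padicIntToCoeffIntegers (Set.range ι) c * B y) → ∀ (Sel₀ : Submodule ↥(padicCoeffIntegers (Set.range ι)) ↥Sg), (∀ s : ↥Sg, s ∈ Sel₀ ↔ (∀ (v' : HeightOneSpectrum (RingOfIntegers ℚ)) (hv' : ((2 : ℕ) : RingOfIntegers ℚ) ∈ v'.asIdeal) (σ : absoluteGaloisGroup ℚ), ∃ (φ : contOneCocycles (discreteTopRep ↥κ.kerSubgroup (Cofree ρ ↥(padicCoeffField (Set.range ι))))) (Q : Fin n → localPoints W (v'.adicCompletion ℚ)) (k : ℕ), oneCocycleClass (discreteTopRep ↥κ.kerSubgroup (Cofree ρ ↥(padicCoeffField (Set.range ι)))) φ = conjH1 κ.kerSubgroup (Cofree ρ ↥(padicCoeffField (Set.range ι))) σ (s : subgroupH1 κ.kerSubgroup (Cofree ρ ↥(padicCoeffField (Set.range ι)))) ∧ (∀ i, (2 ^ k) • Q i ∈ (⊥ : AddSubgroup (localPoints W (v'.adicCompletion ℚ)))) ∧ ∀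 (τ : ↥(localSubgroupOfEmb κ.kerSubgroup (closureEmb (K := ℚ) (v'.adicCompletion ℚ)))) (i : Fin n), pointsMapOfEmb W (closureEmb (K := ℚ) (v'.adicCompletion ℚ)) ((Θ v' hv' (φ.1 (resGalSubgroupOfEmb κ.kerSubgroup (closureEmb (K := ℚ) (v'.adicCompletion ℚ)) τ)) i : ↥(W.geomPrimaryTorsion 2)) : W.geomPoints) = (τ : absoluteGaloisGroup (v'.adicCompletion ℚ)) • Q i - Q i) ∧ (∀ w ∈ S₀, ∀ σ : absoluteGaloisGroup ℚ, conjH1 κ.kerSubgroup (Cofree ρ ↥(padicCoeffField (Set.range ι))) σ (s : subgroupH1 κ.kerSubgroup (Cofree ρ ↥(padicCoeffField (Set.range ι)))) ∈ unramifiedKer κ.kerSubgroup (Cofree ρ ↥(padicCoeffField (Set.range ι))) w)) → ∀ (z : I.H) (D : IwasawaAlgebraO (Set.range ι)), D ≠ 0 → Module.Finite ℚ_[2] (TensorProduct ℤ_[2] ℚ_[2] ((Fin n → PowerSeries ℤ_[2]) ⧸ Submodule.span (PowerSeries ℤ_[2]) ((fun x : I.H => fun i : Fin n => col ((locd₂ x).comp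 (AddMonoidHom.single (fun _ : Fin n => ↥(Sprung2012.localTowerPointsOfEmb κ (closureEmb (K := ℚ) (v.adicCompletion ℚ)) W)) i))) '' (↑(Submodule.span (IwasawaAlgebraO (Set.range ι)) ({z} : Set I.H)) : Set I.H)))) → f * (d + Module.finrank (FractionRing ↥(padicCoeffIntegers (Set.range ι))) (TensorProduct ↥(padicCoeffIntegers (Set.range ι)) (FractionRing ↥(padicCoeffIntegers (Set.range ι))) (IwasawaAlgebraO (Set.range ι) ⧸ Ideal.span {D}))) ≤ Module.finrank ℚ_[2] (TensorProduct ℤ_[2] ℚ_[2] ((Fin n → PowerSeries ℤ_[2]) ⧸ Submodule.span (PowerSeries ℤ_[2]) ((fun x : I.H => fun i : Fin n => col ((locd₂ x).comp (AddMonoidHom.single (fun _ : Fin n => ↥(Sprung2012.localTowerPointsOfEmb κ (closureEmb (K := ℚ) (v.adicCompletion ℚ)) W)) i))) '' (↑(Submodule.span (IwasawaAlgebraO (Set.range ι)) ({z} : Set I.H)) : Set I.H)))) → Module.Finite (FractionRing ↥(padicCoeffIntegers (Set.range ι))) (TensorProduct ↥(padicCoeffIntegers (Set.range ι)) (FractionRing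 ↥(padicCoeffIntegers (Set.range ι))) (I.H ⧸ Submodule.span (IwasawaAlgebraO (Set.range ι)) ({z} : Set I.H))) → Module.finrank (FractionRing ↥(padicCoeffIntegers (Set.range ι))) (TensorProduct ↥(padicCoeffIntegers (Set.range ι)) (FractionRing ↥(padicCoeffIntegers (Set.range ι))) (I.H ⧸ Submodule.span (IwasawaAlgebraO (Set.range ι)) ({z} : Set I.H))) ≤ Module.finrank (FractionRing ↥(padicCoeffIntegers (Set.range ι))) (TensorProduct ↥(padicCoeffIntegers (Set.range ι)) (FractionRing ↥(padicCoeffIntegers (Set.range ι))) (CharacterModule ↥Sel₀)) + Module.finrank (FractionRing ↥(padicCoeffIntegers (Set.range ι))) (TensorProduct ↥(padicCoeffIntegers (Set.range ι)) (FractionRing ↥(padicCoeffIntegers (Set.range ι))) (IwasawaAlgebraO (Set.range ι) ⧸ Ideal.span {D})) → ∃ (P : Type) (_ : AddCommGroup P) (_ : Module ℤ_[2] P) (H : Type) (_ : AddCommGroup H) (_ : Module ↥(padicCoeffIntegers (Set.range ι)) H) (H2 : Type) (_ : AddCommGroup H2) (_ : Module ↥(padicCoeffIntegers (Set.range ι))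 H2) (pair : P →+ CharacterModule ↥Sg) (locd : H →+ P) (Z : Submodule ↥(padicCoeffIntegers (Set.range ι)) H) (Sel₀ : Submodule ↥(padicCoeffIntegers (Set.range ι)) ↥Sg) (e f : ℕ) (B : (Fin f → ℤ_[2]) ≃+ ↥(padicCoeffIntegers (Set.range ι))), (∀ (z : ℤ_[2]) (c : Fin f → ℤ_[2]), B (z • c) = padicIntToCoeffIntegers (Set.range ι) z * B c) ∧ (∀ (z : ℤ_[2]) (t : P) (s : ↥Sg), pair (z • t) s = pair t (padicIntToCoeffIntegers (Set.range ι) z • s)) ∧ (∀ (z : ℤ_[2]) (x : H), locd (padicIntToCoeffIntegers (Set.range ι) z • x) = z • locd x) ∧ (∀ x ∈ Z, pair (locd x) = 0) ∧ (∀ s ∈ Sel₀, ∀ t : P, pair t s = 0) ∧ (∀ t : P, pair t = 0 → ∃ a : ℤ_[2], a ≠ 0 ∧ ∃ x : H, a • t = locd x) ∧ Module.Finite (FractionRing ↥(padicCoeffIntegers (Set.range ι))) (TensorProduct ↥(padicCoeffIntegers (Set.range ι)) (FractionRing ↥(padicCoeffIntegers (Set.range ι))) (H ⧸ Z)) ∧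 Module.Finite ℚ_[2] (TensorProduct ℤ_[2] ℚ_[2] (P ⧸ Submodule.span ℤ_[2] (locd '' (Z : Set H)))) ∧ f * (d + (∑ v ∈ S₀, 2 ^ padicValNat 2 ((natGenerator v ^ 2 - 1) / 8) * (if natGenerator v ∣ M then (if ‖embCoeff g ι (natGenerator v) - 1‖ < 1 then 1 else 0) else (if ‖embCoeff g ι (natGenerator v)‖ < 1 then 2 else 0))) + e) ≤ Module.finrank ℚ_[2] (TensorProduct ℤ_[2] ℚ_[2] (P ⧸ Submodule.span ℤ_[2] (locd '' (Z : Set H)))) ∧ Module.finrank (FractionRing ↥(padicCoeffIntegers (Set.range ι))) (TensorProduct ↥(padicCoeffIntegers (Set.range ι)) (FractionRing ↥(padicCoeffIntegers (Set.range ι))) (H ⧸ Z)) ≤ Module.finrank (FractionRing ↥(padicCoeffIntegers (Set.range ι))) (TensorProduct ↥(padicCoeffIntegers (Set.range ι)) (FractionRing ↥(padicCoeffIntegers (Set.range ι))) H2) + e ∧ Module.finrank (FractionRing ↥(padicCoeffIntegers (Set.range ι))) (TensorProduct ↥(padicCoeffIntegers (Set.range ι)) (FractionRing ↥(padicCoeffIntegers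 (Set.range ι))) H2) ≤ Module.finrank (FractionRing ↥(padicCoeffIntegers (Set.range ι))) (TensorProduct ↥(padicCoeffIntegers (Set.range ι)) (FractionRing ↥(padicCoeffIntegers (Set.range ι))) (CharacterModule ↥Sel₀))) :
    open Literature.NumberTheory.EllipticCurves GreenbergSelmer GreenbergVatsal2000 Kobayashi2003 ModularForms Rank1Residual Literature.NumberTheory.GaloisRepresentations Literature.NumberTheory.Automorphic IsDedekindDomain NumberField Field Rat.HeightOneSpectrum PowerSeries in ∀ (W : WeierstrassCurve ℚ) [W.IsElliptic] [W.IsGloballyMinimal], ¬ W.HasCM → W.analyticRank = 0 → GoodSS W 2 → W.frobeniusTrace 2 = 0 → W.Δ < 0 → ∀ (M : ℕ) [NeZero M] (g : CuspForm (CongruenceSubgroup.Gamma0 M) 2) (ι : coeffField g →+* PadicAlgCl 2) (Ω : ℂ), Odd M → IsNewform0 g → IsCMForm (liftToGamma1 M 2 g) → cuspCoeff g 2 = 0 → IsCohomologicalPlusPeriod g ι Ω → (∀ ℓ : ℕ, ℓ.Prime → ¬ ℓ ∣ 2 * M * W.conductorNorm ℤ → ‖embCoeff g ι ℓ - (W.frobeniusTrace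 ℓ : PadicAlgCl 2)‖ < 1) → ∀ (κ : ZpExtension ℚ 2) (γ : absoluteGaloisGroup ℚ), κ.IsCyclotomic → κ.IsTopGenerator γ → IsCyclotomicVariable 2 γ → ∀ (S₀ : Finset (HeightOneSpectrum (RingOfIntegers ℚ))), (∀ v ∈ S₀, ((2 : ℕ) : RingOfIntegers ℚ) ∉ v.asIdeal) → (∀ v, ¬ W.HasGoodReductionAt v → v ∈ S₀) → (∀ v, natGenerator v ∣ M → v ∈ S₀) → ∀ (Lp Lm : IwasawaAlgebraO (Set.range ι)) (d : ℕ), IsPollackPairK g ι Ω Lp Lm → (∀ k, ‖coeff k (iwasawaOToPowerSeries (Set.range ι) Lm)‖ ≤ ‖coeff d (iwasawaOToPowerSeries (Set.range ι) Lm)‖) → (∀ k < d, ‖coeff k (iwasawaOToPowerSeries (Set.range ι) Lm)‖ < ‖coeff d (iwasawaOToPowerSeries (Set.range ι) Lm)‖) → ∀ (n : ℕ) (ρ : FramedGaloisRep ℚ ↥(padicCoeffIntegers (Set.range ι)) 2) (Θ : ∀ v : HeightOneSpectrum (RingOfIntegers ℚ), ((2 : ℕ) : RingOfIntegers ℚ)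 ∈ v.asIdeal → (Cofree ρ ↥(padicCoeffField (Set.range ι)) ≃+ (Fin n → ↥(W.geomPrimaryTorsion 2)))), (∀ v, ¬ natGenerator v ∣ 2 * M → ρ.IsUnramifiedAt v ∧ ∃ P : Polynomial ↥(padicCoeffIntegers (Set.range ι)), P.map (padicCoeffIntegers (Set.range ι)).subtype = Polynomial.X ^ 2 - Polynomial.C (embCoeff g ι (natGenerator v)) * Polynomial.X + Polynomial.C ((natGenerator v : ℕ) : PadicAlgCl 2) ∧ ρ.HasFrobCharpolyAt v P) → (∀ v hv (δ : absoluteGaloisGroup (v.adicCompletion ℚ)) m i, Θ v hv (resGalOfEmb (closureEmb (K := ℚ) (v.adicCompletion ℚ)) δ • m) i = resGalOfEmb (closureEmb (K := ℚ) (v.adicCompletion ℚ)) δ • Θ v hv m i) → ∀ (ϖ : ↥(padicCoeffIntegers (Set.range ι))), Irreducible ϖ → ((Nat.card (↥(padicCoeffIntegers (Set.range ι)) ⧸ Ideal.span {ϖ}) ^ (d + ∑ v ∈ S₀, 2 ^ padicValNat 2 ((natGenerator v ^ 2 - 1) / 8) * (if natGenerator v ∣ M then (if ‖embCoeff g ι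 (natGenerator v) - 1‖ < 1 then 1 else 0) else (if ‖embCoeff g ι (natGenerator v)‖ < 1 then 2 else 0))) : ℕ) : ℕ∞) ≤ {y : subgroupH1 κ.kerSubgroup (Cofree ρ ↥(padicCoeffField (Set.range ι))) | y ∈ unramifiedOutside κ.kerSubgroup (Cofree ρ ↥(padicCoeffField (Set.range ι))) 2 ↑S₀ ∧ (∀ w σ, conjH1 κ.kerSubgroup (Cofree ρ ↥(padicCoeffField (Set.range ι))) σ y ∈ infKer κ.kerSubgroup (Cofree ρ ↥(padicCoeffField (Set.range ι))) w) ∧ (∀ v hv σ, ∃ (φ : _) (Q : Fin n → localPoints W (v.adicCompletion ℚ)) (k : ℕ), oneCocycleClass (discreteTopRep ↥κ.kerSubgroup (Cofree ρ ↥(padicCoeffField (Set.range ι)))) φ = conjH1 κ.kerSubgroup (Cofree ρ ↥(padicCoeffField (Set.range ι))) σ y ∧ (∀ i, (2 ^ k) • Q i ∈ ⨆ m : ℕ, signedLocalPoints κ (v.adicCompletion ℚ) W 1 m) ∧ ∀ τ i, pointsMapOfEmb W (closureEmb (K := ℚ) (v.adicCompletion ℚ)) (((Θ v hv (φ.1 (resGalSubgroupOfEmb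 κ.kerSubgroup (closureEmb (K := ℚ) (v.adicCompletion ℚ)) τ))) i : ↥(W.geomPrimaryTorsion 2)) : W.geomPoints) = (τ : absoluteGaloisGroup (v.adicCompletion ℚ)) • Q i - Q i) ∧ scalarH1 κ.kerSubgroup (Cofree ρ ↥(padicCoeffField (Set.range ι))) ϖ y = 0}.encard := by
  refine LambdaLowerBoundO.cmLambdaLower_of_intDualityData ?_
  intro W _ _ hCM hr0 hss ha2 hΔ M _ g ι Ω hM hnew hcmf ha2g hΩ hcong κ γ hκ hγ hcyc S₀ hS₀ hbad hMS Lp Lm d hpair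
    hle hlt n ρ Θ hρ hΘ ϖ hϖ Sg inst hsmul hmem hconj hfin
  haveI : FiniteDimensional ℚ (ModularForms.coeffField g) := ModularForms.IsNewform0.finiteDimensional_coeffField_holds hnew
  haveI : FiniteDimensional ℚ_[2] ↥(padicCoeffField (Set.range ι)) := GreenbergSelmer.finiteDimensional_padicCoeffField ι
  -- NB: no `obtain`/`rcases` below — pattern matching generalises the (huge) goal and times out; `Exists.elim`/`Nonempty.elim`/projections only.
  -- the place of `ℚ` above `2`
  have hv₂ : ((2 : ℕ) : 𝓞 ℚ) ∈ ((Rat.HeightOneSpectrum.primesEquiv (R := 𝓞 ℚ)).symm ⟨2, Nat.prime_two⟩).asIdeal :=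
    (natCast_mem_asIdeal_iff_eq_primesEquiv_symm _ Nat.prime_two).mpr rfl
  refine (⟨_, hv₂⟩ : ∃ v : HeightOneSpectrum (𝓞 ℚ), ((2 : ℕ) : 𝓞 ℚ) ∈ v.asIdeal).elim fun v₂ hv₂ ↦ ?_
  have hv₂' : (2 : 𝓞 ℚ) ∈ v₂.asIdeal := by rw [← Nat.cast_ofNat]; exact hv₂
  -- Kato's datum and its `𝒪`-structure `a ↦ C a`
  refine (hK0a 2 M g ι ρ κ γ hnew hρ hκ hγ).elim fun I ↦ ?_
  letI instH : Module ↥(padicCoeffIntegers (Set.range ι)) I.H :=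
    Module.compHom I.H (PowerSeries.C (R := ↥(padicCoeffIntegers (Set.range ι))))
  have hsmulH : ∀ (a : ↥(padicCoeffIntegers (Set.range ι))) (x : I.H), a • x = (PowerSeries.C a : IwasawaAlgebraO (Set.range ι)) • x :=
    fun _ _ ↦ rfl
  haveI : IsScalarTower ↥(padicCoeffIntegers (Set.range ι)) (IwasawaAlgebraO (Set.range ι)) I.H :=
    ⟨fun a F x ↦ by rw [hsmulH, ← mul_smul, Algebra.smul_def, PowerSeries.algebraMap_apply]; rfl⟩
  -- Frobenius data
  refine (ThetaTransport.exists_dualGenerator (Set.range ι)).elim fun t₀ h ↦ h.elim fun nb h ↦ h.elim fun bO h ↦ h.elim fun bO' hFrob ↦ ?_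
  have ht₀ := hFrob.1
  have hbO := hFrob.2.1
  -- THE pinned pairing family
  refine (ThetaTransport.exists_rhoLayerPairing_pinned_of_crux (Set.range ι) ρ (fun v ↦ embCoeff g ι (natGenerator v)) hρ t₀ ht₀ W (Θ v₂ hv₂) κ v₂
    (hΘ v₂ hv₂)).elim fun ePk h ↦ h.elim fun hμ h ↦ h.elim fun hadd₁ h ↦ h.elim fun hadd₂ h ↦ h.elim fun hgal h ↦ h.elim fun hcompat hrest ↦ ?_
  refine hrest.1.elim fun ζ hζall ↦ ?_
  have hζ := hζall.1
  have hval := hζall.2.2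
  refine hrest.2.2.elim fun pr hpr2 ↦ ?_
  have hprdef := hpr2.1
  have hpr := hpr2.2
  have hP1 : ∀ (m : ℕ) (x : H1 (FramedGaloisRep.toGaloisRep ρ) (κ.layerSubgroup (m + 1))) (Q : Fin n → localPoints W (v₂.adicCompletion ℚ))
      (hQ : ∀ i, Q i ∈ localLayerPointsOfEmb κ (closureEmb (K := ℚ) (v₂.adicCompletion ℚ)) W m),
      pr m (Kato2004.layerCores (FramedGaloisRep.toGaloisRep ρ) κ m x) (fun i ↦ ⟨Q i, hQ i⟩) =
        pr (m + 1) x (fun i ↦ ⟨Q i, Kobayashi2003.localLayerPointsOfEmb_mono κ (closureEmb (K := ℚ) (v₂.adicCompletion ℚ)) W (Nat.le_succ m) (hQ i)⟩) := by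
    intro m x Q hQ
    rw [hprdef, hprdef]
    exact ThetaTransport.rhoLayerPairingAdic_layerCores (Set.range ι) ρ W (Θ v₂ hv₂) κ v₂ (hΘ v₂ hv₂) ePk hμ hadd₁ hadd₂ hgal hκ hv₂ hcompat m x Q hQ
  -- the glue `locd₂`
  refine (ThetaTransport.exists_locd₂_of_layerCores I W v₂ pr hP1).elim fun locd₂ hlocd₂ ↦ ?_
  -- the plus Coleman map over `ℤ₂`
  refine (SignedColemanImage.exists_colemanPlusHom_coeff_two W hss ha2 κ hκ v₂ hv₂').elim fun gH h ↦ h.elim fun dH h ↦ h.elim fun hdA hH ↦ ?_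
  refine (hH.2.2.2.2 ℤ_[2]).elim fun col hcol ↦ ?_
  -- the basis and the strict/primitive submodule
  refine (LambdaLowerBoundO.exists_addEquiv_padicInt_pi (Set.range ι)).elim fun f h ↦ h.elim fun B hB ↦ ?_
  refine (ThetaTransport.exists_submodule_strictAtTwo W (Set.range ι) κ ρ hss ha2 Θ hΘ Sg hsmul).elim fun Str hStr ↦ ?_
  refine (ThetaTransport.exists_submodule_primitive κ.kerSubgroup (Cofree ρ ↥(padicCoeffField (Set.range ι))) Sg hsmul (↑S₀ : Set (HeightOneSpectrum (𝓞 ℚ)))).elim fun Prim hPrim ↦ ?_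
  have hSel₀ := fun s : ↥Sg ↦ (Submodule.mem_inf (p := Str) (q := Prim) (x := s)).trans (and_congr (hStr s) (hPrim s))
  -- S3's zeta element, then the supply
  refine (hS3 W hCM hr0 hss ha2 hΔ M g ι Ω hM hnew hcmf ha2g hΩ hcong κ γ hκ hγ hcyc S₀ hS₀ hbad hMS Lp Lm d
    hpair hle hlt n ρ Θ hρ hΘ ϖ hϖ Sg hsmul hmem hconj hfin v₂ hv₂ I hsmulH t₀ ht₀ nb bO bO' hbO ζ hζ ePk hμ hadd₁ hadd₂ hgal hval pr hpr
    locd₂ hlocd₂ col ⟨gH, dH, hdA, hH.1, hH.2.1, hH.2.2.1, hH.2.2.2.1, hcol.1, hcol.2.1⟩ hcol.2.2.1 hcol.2.2.2 f B hB (Str ⊓ Prim) hSel₀).elim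
    fun z h ↦ h.elim fun D hzD ↦ ?_
  exact hsup W hCM hr0 hss ha2 hΔ M g ι Ω hM hnew hcmf ha2g hΩ hcong κ γ hκ hγ hcyc S₀ hS₀ hbad hMS Lp Lm d hpair hle hlt n ρ Θ hρ hΘ
    ϖ hϖ Sg hsmul hmem hconj hfin v₂ hv₂ I hsmulH t₀ ht₀ nb bO bO' hbO ζ hζ ePk hμ hadd₁ hadd₂ hgal hval pr hpr locd₂ hlocd₂ col
    ⟨gH, dH, hdA, hH.1, hH.2.1, hH.2.2.1, hH.2.2.2.1, hcol.1, hcol.2.1⟩ hcol.2.2.1 hcol.2.2.2 f B hB (Str ⊓ Prim) hSel₀ z D hzD.1 hzD.2.1 hzD.2.2.1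
    hzD.2.2.2.1 hzD.2.2.2.2

end Summit.BirchSwinnertonDyer.BirchSwinnertonDyer.Theorems.LambdaLowerBoundO

end
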